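import Literature.MathematicalPhysics.QuantumFieldTheory.Balaban1983to89.TorusGeometry
import Literature.MathematicalPhysics.QuantumFieldTheory.Balaban1983to89.B15DeterminingSets
import Summits.QuantumFields.BalabanUV.T4Continuum.Spine.NE7.QLaConeLocality

/-!
# Spine/NE7/QLaConeNeighbourhood — the CANONICAL cone for file 40: measured centre to centre in the finest lattice, the
# bonds feeding an `n`-fold averaged loop lie within `(d+2)·(L^{k+n} − L^k)` of the loop's sites, so NODE S's defect bound
# charges only the large-field bonds in that ℓ¹-neighbourhood (`loopDefect_le_of_near_support`)

Cell `pub-balaban-gaps` (YM blitz Y1, track G2, seat `ne7`, generation 11); text of record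
`run/shared/lean/pub/pub-balaban-gaps/ne/NE7.md` (v11: census R68).  41st `Spine/NE7/` file; 0 `def`, 0 sorry.

WHY.  File 40 (`QLaConeLocality`) put NODE S's defect bound in CONE FORM for an ARBITRARY downward-closed family of bond sets
`D i ⊆ bonds of T^{(k+i)}` supplied by the consumer (`loopDefect_le_of_cone_support`, hypothesis `hclosed`).  This file supplies
the canonical family, with NO cone object: all levels are compared inside the FINEST lattice `T^{(0)}` through the tree's iterated
centre embedding `B15DeterminingSets.embIter : Site P j → Site P 0` ([Balaban1987RG1] p. 251: *"Each lattice determines a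
lattice of centers of these cubes"*; `Setup.emb` = B12's centred convention, `L` odd), and `D i` is the set of level-`(k+i)`
bonds whose source CENTRE lies within `ℓ¹`-distance `R i` of the centre of a site of the loop.  Three kernel facts about the torus
geometry of `Setup` make this family closed under the one-step dependence of `Setup.Averaging.local_dep`: (1) the centre
embedding is an EXACT DILATION of the `ℓ¹` torus metric, `tdist (emb y) (emb y′) = L·tdist y y′` (`tdist_emb`; per coordinate
the label difference scales by `L` because the site counts do, `Params.sitesPerDir_eq_mul_succ`), hence
`tdist (embIter j y) (embIter j y′) = L^j·tdist y y′` (`tdist_embIter`); (2) a site is within `d(L−1)` of the centre of its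
block (`tdist_emb_blockOf_le`, same `L`-quotient of the labels); (3) nearest neighbours are at distance `≤ 1`.  So one
descent step costs at most `(d(L−1) + L)·L^{k+i} ≤ (d+2)(L−1)·L^{k+i}` of radius (`cone_closed_of_radius`), the telescoping choice
`R i = (d+2)·(L^{k+n} − L^{k+i})` has `R n = 0` (the loop's own bonds) and `R 0 = (d+2)·(L^{k+n} − L^k) < (d+2)` top-block sides,
and file 40's theorem specialises to **`loopDefect_le_of_near_support`**: under `LoopDefectBound av dom Cd θ`,
`1 − W(avgⁿ V)(walk x w) ≤ Cd·(|w|·|Λ_near|·Dm)²·(θ²)ⁿ`, where `Λ_near ⊆ Λ` are the large-field bonds whose source centre is within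
`(d+2)·(L^{k+n} − L^k)` (finest-lattice `ℓ¹` units) of the centre of a site of the loop — the support farther away is NOT charged.
How many renormalised components a good history may carry in that neighbourhood per scale stays route 1's near-support
multiplicity ∕ the hybrid's `Bad` booking (rows NE7b∕NE7c), not NE7-own (file 40's caveat, unchanged).

HONEST FRAMING.  Finite torus geometry and one application of file 40; every declaration is [folklore]; no object of Bałaban's
is constructed.  NE7 NOT proved; spine 0∕9; one fixed finite T⁴ — NOT ℝ⁴, NOT infinite volume, NOT a mass gap, NOT Clay.  No
classification word moves (R10).
-/

noncomputable section

open Finset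
open scoped BigOperators

namespace Summit.QuantumFields.BalabanUV.T4Continuum.Spine.NE7

open Literature.MathematicalPhysics.QuantumFieldTheory.Balaban1983to89
open Literature.MathematicalPhysics.QuantumFieldTheory.Balaban1983to89.T4Continuum
open Literature.MathematicalPhysics.QuantumFieldTheory.Balaban1983to89.T4AvgSensitivity
open Literature.MathematicalPhysics.QuantumFieldTheory.Balaban1983to89.T4AvgDerivBound
open Literature.MathematicalPhysics.QuantumFieldTheory.Balaban1983to89.B15DeterminingSets (embIter)

variable {P : Params}

/-! ## §1 Torus geometry of `Setup`: the centre embedding dilates the `ℓ¹` metric by `L` -/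

section Torus

variable {j : ℕ}

/-- kernel: the `ℓ¹` torus distance is symmetric (the tree's `B3Taylor310LocalRemainder.tdist_comm`, re-proved to keep this
file inside the YM series' imports). [folklore] -/
private theorem tdist_comm' (x y : Site P j) : Site.tdist x y = Site.tdist y x := by
  simp only [Site.tdist, min_comm]

/-- kernel: one coordinate of the torus distance is the least absolute residue. [folklore] -/
private theorem min_val_eq_natAbs {n : ℕ} [NeZero n] (a : ZMod n) : min a.val (-a).val = a.valMinAbs.natAbs := by
  rw [ZMod.valMinAbs_natAbs_eq_min, ZMod.neg_val]
  split_ifs with h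
  · subst h; simp
  · rfl

/-- kernel: triangle inequality for the `ℓ¹` torus distance (the tree's `B3Taylor310LocalRemainder.tdist_triangle`, re-proved
for the same reason). [folklore] -/
private theorem tdist_triangle' (x y z : Site P j) : Site.tdist x z ≤ Site.tdist x y + Site.tdist y z := by
  unfold Site.tdist
  rw [← Finset.sum_add_distrib]
  refine Finset.sum_le_sum fun μ _ => ?_
  have h1 : z μ - x μ = -(x μ - z μ) := by ring
  have h2 : y μ - x μ = -(x μ - y μ) := by ring
  have h3 : z μ - y μ = -(y μ - z μ) := by ring
  rw [h1, h2, h3, min_val_eq_natAbs, min_val_eq_natAbs, min_val_eq_natAbs]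
  have h : x μ - z μ = (x μ - y μ) + (y μ - z μ) := by ring
  rw [h]
  exact (ZMod.natAbs_valMinAbs_add_le _ _).trans (Int.natAbs_add_le _ _)

/-- kernel: the distance vanishes on the diagonal. [folklore] -/
private theorem tdist_self' (x : Site P j) : Site.tdist x x = 0 := by
  simp [Site.tdist]

/-- kernel: two natural labels within `c` of each other are within torus distance `c`. [folklore] -/
private theorem min_val_natCast_sub_le {N : ℕ} [NeZero N] {a b c : ℕ} (h1 : a ≤ b + c) (h2 : b ≤ a + c) :
    min (((a : ZMod N) - b).val) (((b : ZMod N) - a).val) ≤ c := by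
  rcases le_total a b with hab | hba
  · refine min_le_of_right_le ?_
    rw [← Nat.cast_sub hab, ZMod.val_natCast]
    exact (Nat.mod_le _ _).trans (by omega)
  · refine min_le_of_left_le ?_
    rw [← Nat.cast_sub hba, ZMod.val_natCast]
    exact (Nat.mod_le _ _).trans (by omega)

/-- **Nearest neighbours are at distance at most one**: `tdist y (y + e_μ) ≤ 1`. [folklore] -/
private theorem tdist_shift_le_one' (y : Site P j) (μ : Fin P.d) : Site.tdist y (y.shift μ) ≤ 1 := by
  unfold Site.tdist
  have h1 : ∀ ν : Fin P.d, min (y ν - y.shift μ ν).val (y.shift μ ν - y ν).val ≤ if ν = μ then 1 else 0 := by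
    intro ν
    by_cases h : ν = μ
    · subst h
      simp only [Site.shift, Function.update_self, add_sub_cancel_left, if_true]
      exact min_le_of_right_le (ZMod.val_one (P.sitesPerDir j)).le
    · simp [Site.shift, h]
  calc ∑ ν : Fin P.d, min (y ν - y.shift μ ν).val (y.shift μ ν - y ν).val
      ≤ ∑ ν : Fin P.d, (if ν = μ then 1 else 0) := Finset.sum_le_sum fun ν _ => h1 ν
    _ = 1 := by simp

/-- **THE CENTRE EMBEDDING SCALES LABEL DIFFERENCES BY `L`** (per coordinate, exactly): for `y, y′ ∈ T^{(j+1)}`,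
`((emb y)_μ − (emb y′)_μ).val = L·((y_μ − y′_μ).val)` — because `|T^{(j)}| = L·|T^{(j+1)}|` per direction
(`Params.sitesPerDir_eq_mul_succ`, standing range `j + 1 ≤ m + K`) and `emb` has labels `n ↦ nL + (L−1)/2`. [folklore] -/
theorem val_emb_sub_emb (hj : j + 1 ≤ P.m + P.K) (y y' : Site P (j + 1)) (μ : Fin P.d) :
    ((emb y) μ - (emb y') μ).val = P.L * (y μ - y' μ).val := by
  set a := (y μ).val with ha
  set a' := (y' μ).val with ha'
  set δ := (y μ - y' μ).val with hδ
  have hN : P.sitesPerDir j = P.sitesPerDir (j + 1) * P.L := P.sitesPerDir_eq_mul_succ hj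
  -- `a ≡ a' + δ` modulo the coarse site count
  have hmod : a ≡ a' + δ [MOD P.sitesPerDir (j + 1)] := by
    rw [← ZMod.natCast_eq_natCast_iff, Nat.cast_add, ha, ha', hδ, ZMod.natCast_zmod_val, ZMod.natCast_zmod_val,
      ZMod.natCast_zmod_val]
    ring
  -- multiply by `L`, add the centre offset, and read it in the fine site count
  have hmod' : a * P.L + (P.L - 1) / 2 ≡ (a' * P.L + (P.L - 1) / 2) + δ * P.L [MOD P.sitesPerDir j] := by
    rw [hN, show a' * P.L + (P.L - 1) / 2 + δ * P.L = (a' + δ) * P.L + (P.L - 1) / 2 by ring]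
    exact (hmod.mul_right' P.L).add_right _
  have hcast := (ZMod.natCast_eq_natCast_iff _ _ _).mpr hmod'
  have hey : (emb y) μ = ((a * P.L + (P.L - 1) / 2 : ℕ) : ZMod (P.sitesPerDir j)) := rfl
  have hey' : (emb y') μ = ((a' * P.L + (P.L - 1) / 2 : ℕ) : ZMod (P.sitesPerDir j)) := rfl
  rw [hey, hey', hcast, Nat.cast_add, add_sub_cancel_left, ZMod.val_natCast, Nat.mod_eq_of_lt, mul_comm]
  -- no wrap-around: `δ·L < |T^{(j)}|`
  have hδlt : δ < P.sitesPerDir (j + 1) := ZMod.val_lt _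
  rw [hN]
  have hL : 0 < P.L := P.L_pos
  nlinarith

/-- **THE CENTRE EMBEDDING IS AN EXACT DILATION**: `tdist (emb y) (emb y′) = L·tdist y y′` (`j + 1 ≤ m + K`). [folklore] -/
theorem tdist_emb (hj : j + 1 ≤ P.m + P.K) (y y' : Site P (j + 1)) :
    Site.tdist (emb y) (emb y') = P.L * Site.tdist y y' := by
  unfold Site.tdist
  rw [Finset.mul_sum]
  refine Finset.sum_congr rfl fun μ _ => ?_
  rw [val_emb_sub_emb hj y y' μ, val_emb_sub_emb hj y' y μ, Nat.mul_min_mul_left]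

/-- **… AND SO IS ITS ITERATE**: `tdist (embIter j y) (embIter j y′) = L^j·tdist y y′` (`j ≤ m + K`). [folklore] -/
theorem tdist_embIter : ∀ {j : ℕ}, j ≤ P.m + P.K → ∀ y y' : Site P j,
    Site.tdist (embIter j y) (embIter j y') = P.L ^ j * Site.tdist y y'
  | 0, _, y, y' => by simp [embIter]
  | j + 1, hj, y, y' => by
    show Site.tdist (embIter j (emb y)) (embIter j (emb y')) = _
    rw [tdist_embIter (by omega), tdist_emb hj, pow_succ, mul_assoc]

/-- **A SITE IS WITHIN `d(L−1)` OF THE CENTRE OF ITS BLOCK**: `tdist x (emb (blockOf x)) ≤ d·(L − 1)` — per coordinate the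
labels `n` and `(n/L)·L + (L−1)/2` have the same quotient by `L` (`Site.val_blockOf`, `Site.val_emb`). [folklore] -/
theorem tdist_emb_blockOf_le (hj : j + 1 ≤ P.m + P.K) (x : Site P j) :
    Site.tdist x (emb (blockOf x)) ≤ P.d * (P.L - 1) := by
  unfold Site.tdist
  have hL : 0 < P.L := P.L_pos
  have hcoord : ∀ μ : Fin P.d,
      min (x μ - (emb (blockOf x)) μ).val ((emb (blockOf x)) μ - x μ).val ≤ P.L - 1 := by
    intro μ
    have he : (emb (blockOf x)) μ =
        ((((blockOf x) μ).val * P.L + (P.L - 1) / 2 : ℕ) : ZMod (P.sitesPerDir j)) := rfl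
    rw [he, Site.val_blockOf hj x μ]
    set n := (x μ).val with hn
    have hx : x μ = ((n : ℕ) : ZMod (P.sitesPerDir j)) := (ZMod.natCast_zmod_val _).symm
    rw [hx]
    have hdm : n / P.L * P.L + n % P.L = n := Nat.div_add_mod' n P.L
    have hml : n % P.L < P.L := Nat.mod_lt n hL
    set T := n / P.L * P.L with hT
    exact min_val_natCast_sub_le (by omega) (by omega)
  calc ∑ μ : Fin P.d, min (x μ - (emb (blockOf x)) μ).val ((emb (blockOf x)) μ - x μ).val
      ≤ ∑ _μ : Fin P.d, (P.L - 1) := Finset.sum_le_sum fun μ _ => hcoord μ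
    _ = P.d * (P.L - 1) := by simp

/-- In the finest lattice: the centre of `x ∈ T^{(j)}` is within `L^j·d(L−1)` of the centre of its block `blockOf x ∈ T^{(j+1)}`.
[folklore] -/
theorem tdist_embIter_blockOf_le (hj : j + 1 ≤ P.m + P.K) (x : Site P j) :
    Site.tdist (embIter j x) (embIter (j + 1) (blockOf x)) ≤ P.L ^ j * (P.d * (P.L - 1)) := by
  show Site.tdist (embIter j x) (embIter j (emb (blockOf x))) ≤ _
  rw [tdist_embIter (by omega)]
  exact Nat.mul_le_mul_left _ (tdist_emb_blockOf_le hj x)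

/-- In the finest lattice: the centres of nearest neighbours of `T^{(j)}` are within `L^j`. [folklore] -/
theorem tdist_embIter_shift_le (hj : j ≤ P.m + P.K) (y : Site P j) (μ : Fin P.d) :
    Site.tdist (embIter j y) (embIter j (y.shift μ)) ≤ P.L ^ j := by
  rw [tdist_embIter hj]
  calc P.L ^ j * Site.tdist y (y.shift μ) ≤ P.L ^ j * 1 := Nat.mul_le_mul_left _ (tdist_shift_le_one' y μ)
    _ = P.L ^ j := mul_one _

end Torus

/-! ## §2 The metric cone below a walk is closed under one-step dependence -/

section Cone

variable {G : Type*} [GaugeGroup G]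

/-- **ONE DESCENT STEP COSTS AT MOST `(d(L−1) + L)·L^{k+i}` OF RADIUS.**  Fix a walk `(x, w)` of `T^{(k+n)}` (`k + n ≤ m + K`) and
radii `R i` with `R (i+1) + (d(L−1) + L)·L^{k+i} ≤ R i` for `i < n`.  Let `D i` be the level-`(k+i)` bonds (`i ≤ n`) whose source
centre is within `ℓ¹`-distance `R i` (finest lattice) of the centre of the source of a step of the walk (hypothesis `hD`: any
family with this membership).  Then `D` is closed downwards under the one-step dependence of `Setup.Averaging.local_dep` — the
hypothesis `hclosed` of file 40. [folklore] -/
theorem cone_closed_of_radius {k n : ℕ} (hn : k + n ≤ P.m + P.K) (x : Site P (k + n)) (w : List (Letter P.d))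
    (R : ℕ → ℕ) (hR : ∀ i, i < n → R (i + 1) + (P.d * (P.L - 1) + P.L) * P.L ^ (k + i) ≤ R i)
    (D : (i : ℕ) → Set (PBond P (k + i)))
    (hD : ∀ i (b : PBond P (k + i)), b ∈ D i ↔ i ≤ n ∧ ∃ s ∈ walk x w,
      Site.tdist (embIter (k + i) b.src) (embIter (k + n) s.bond.src) ≤ R i) :
    ∀ i, ∀ c ∈ D (i + 1), ∀ b : PBond P (k + i),
      (blockOf b.src = c.src ∨ blockOf b.src = c.tgt) → b ∈ D i := by
  intro i c hc b hb
  obtain ⟨hi, s, hs, hcs⟩ := (hD (i + 1) c).mp hc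
  refine (hD i b).mpr ⟨by omega, s, hs, ?_⟩
  have hki : k + i + 1 ≤ P.m + P.K := by omega
  -- the source of `b` is within `L^{k+i}·d(L−1)` of the centre of its block
  have h1 : Site.tdist (embIter (k + i) b.src) (embIter (k + i + 1) (blockOf b.src)) ≤ P.L ^ (k + i) * (P.d * (P.L - 1)) :=
    tdist_embIter_blockOf_le hki b.src
  -- that block is an endpoint of `c`, within `L^{k+i+1}` of `c.src`
  have h2 : Site.tdist (embIter (k + i + 1) (blockOf b.src)) (embIter (k + n) s.bond.src) ≤ P.L ^ (k + i + 1) + R (i + 1) := by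
    rcases hb with hb | hb
    · rw [hb]
      exact hcs.trans (Nat.le_add_left _ _)
    · rw [hb]
      calc Site.tdist (embIter (k + i + 1) c.tgt) (embIter (k + n) s.bond.src)
          ≤ Site.tdist (embIter (k + i + 1) c.tgt) (embIter (k + i + 1) c.src)
            + Site.tdist (embIter (k + i + 1) c.src) (embIter (k + n) s.bond.src) := tdist_triangle' _ _ _
        _ ≤ P.L ^ (k + i + 1) + R (i + 1) := by
          refine Nat.add_le_add ?_ hcs
          rw [tdist_comm']
          exact tdist_embIter_shift_le hki c.src c.dir
  have h3 := hR i (by omega)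
  have hpow : P.L ^ (k + i + 1) = P.L ^ (k + i) * P.L := pow_succ _ _
  calc Site.tdist (embIter (k + i) b.src) (embIter (k + n) s.bond.src)
      ≤ Site.tdist (embIter (k + i) b.src) (embIter (k + i + 1) (blockOf b.src))
        + Site.tdist (embIter (k + i + 1) (blockOf b.src)) (embIter (k + n) s.bond.src) := tdist_triangle' _ _ _
    _ ≤ P.L ^ (k + i) * (P.d * (P.L - 1)) + (P.L ^ (k + i + 1) + R (i + 1)) := Nat.add_le_add h1 h2
    _ = R (i + 1) + (P.d * (P.L - 1) + P.L) * P.L ^ (k + i) := by rw [hpow]; ring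
    _ ≤ R i := h3

/-- The walk's own bonds lie in the top of the cone as soon as `0 ≤ R n` (distance zero to themselves). [folklore] -/
theorem walk_mem_cone_top {k n : ℕ} (x : Site P (k + n)) (w : List (Letter P.d)) (R : ℕ → ℕ)
    (D : (i : ℕ) → Set (PBond P (k + i)))
    (hD : ∀ i (b : PBond P (k + i)), b ∈ D i ↔ i ≤ n ∧ ∃ s ∈ walk x w,
      Site.tdist (embIter (k + i) b.src) (embIter (k + n) s.bond.src) ≤ R i) :
    ∀ s ∈ walk x w, s.bond ∈ D n := fun s hs =>
  (hD n s.bond).mpr ⟨le_rfl, s, hs, by rw [tdist_self']; exact Nat.zero_le _⟩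

/-- **THE TELESCOPING RADII** `R i = (d+2)·(L^{k+n} − L^{k+i})` satisfy the descent condition (`L ≥ 2`:
`d(L−1) + L ≤ (d+2)(L−1)`), with `R n = 0`. [folklore] -/
theorem radius_step (k n i : ℕ) (hi : i < n) :
    (P.d + 2) * (P.L ^ (k + n) - P.L ^ (k + (i + 1))) + (P.d * (P.L - 1) + P.L) * P.L ^ (k + i)
      ≤ (P.d + 2) * (P.L ^ (k + n) - P.L ^ (k + i)) := by
  have hL : 2 ≤ P.L := P.hL.2
  have hL1 : 1 ≤ P.L := by omega
  set a := P.L ^ (k + i) with ha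
  have hsucc : P.L ^ (k + (i + 1)) = P.L * a := by rw [ha, ← pow_succ', Nat.add_assoc]
  have hab : a ≤ P.L * a := Nat.le_mul_of_pos_left _ (by omega)
  have hbc : P.L * a ≤ P.L ^ (k + n) := by
    rw [← hsucc]; exact Nat.pow_le_pow_right hL1 (by omega)
  rw [hsucc]
  -- `(d(L−1) + L)·a ≤ (d+2)·(L·a − a)`
  have hstep : (P.d * (P.L - 1) + P.L) * a ≤ (P.d + 2) * (P.L * a - a) := by
    have h1 : P.L * a - a = (P.L - 1) * a := by
      rw [Nat.sub_mul, one_mul]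
    rw [h1, ← mul_assoc]
    refine Nat.mul_le_mul_right _ ?_
    rw [add_mul]
    omega
  calc (P.d + 2) * (P.L ^ (k + n) - P.L * a) + (P.d * (P.L - 1) + P.L) * a
      ≤ (P.d + 2) * (P.L ^ (k + n) - P.L * a) + (P.d + 2) * (P.L * a - a) := Nat.add_le_add_left hstep _
    _ = (P.d + 2) * (P.L ^ (k + n) - a) := by rw [← mul_add, Nat.sub_add_sub_cancel hbc hab]

end Cone

/-! ## §3 NODE S's defect bound charges only the large-field bonds near the loop -/

section Defect

variable {G : Type*} [GaugeGroup G]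

open Classical in
/-- **THE DEFECT BOUND WITH THE CANONICAL CONE.**  Under `LoopDefectBound av dom Cd θ` (file 5; PROVED for the printed averagings
on the files' domains), for a closed walk `(x, w)` of `T^{(k+n)}`, a configuration `V ∈ dom k` trivial off a finite bond set `Λ`
with one-bond deviations `≤ Dm` on `Λ`, and the truncation hypothesis `htrunc` of file 40 (automatic for sup-ball domains):
`1 − W(avgⁿ V)(walk x w) ≤ Cd·(|w|·|Λ_near|·Dm)²·(θ²)ⁿ`, where `Λ_near` (`hΛD`) consists of the bonds of `Λ` whose source CENTRE
lies within `ℓ¹`-distance `(d+2)·(L^{k+n} − L^k)` — fewer than `d + 2` top-block sides, finest-lattice units — of the centre of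
the source of a step of the loop.  The large-field support farther from the loop is NOT charged. [folklore] -/
theorem loopDefect_le_of_near_support {av : ∀ j, Averaging P j G} {dom : ∀ j, Set (GaugeField P j G)} {Cd θ : ℝ}
    (h : LoopDefectBound av dom Cd θ) (hCd : 0 ≤ Cd) (hθ : 0 ≤ θ) {k n : ℕ} (hn : k + n ≤ P.m + P.K)
    (x : Site P (k + n)) (w : List (Letter P.d)) (hw : walkEnd x w = x)
    (V : GaugeField P k G) (h1 : (1 : GaugeField P k G) ∈ dom k) (Λ ΛD : Finset (PBond P k))
    (hΛD : ∀ b, b ∈ ΛD ↔ b ∈ Λ ∧ ∃ s ∈ walk x w,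
      Site.tdist (embIter k b.src) (embIter (k + n) s.bond.src) ≤ (P.d + 2) * (P.L ^ (k + n) - P.L ^ k))
    (hoff : ∀ b, b ∉ Λ → V b = 1) {Dm : ℝ} (hD : ∀ b ∈ Λ, dist1 (V b) ≤ Dm)
    (htrunc : (fun b => if b ∈ ΛD then V b else 1) ∈ dom k) :
    1 - loopAt (iterFrom av k n V) (walk x w) ≤ Cd * ((w.length : ℝ) * ΛD.card * Dm) ^ 2 * (θ ^ 2) ^ n := by
  -- the canonical cone and its radii
  let R : ℕ → ℕ := fun i => (P.d + 2) * (P.L ^ (k + n) - P.L ^ (k + i))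
  let D : (i : ℕ) → Set (PBond P (k + i)) := fun i =>
    {b | i ≤ n ∧ ∃ s ∈ walk x w, Site.tdist (embIter (k + i) b.src) (embIter (k + n) s.bond.src) ≤ R i}
  have hDmem : ∀ i (b : PBond P (k + i)), b ∈ D i ↔ i ≤ n ∧ ∃ s ∈ walk x w,
      Site.tdist (embIter (k + i) b.src) (embIter (k + n) s.bond.src) ≤ R i := fun _ _ => Iff.rfl
  have hR : ∀ i, i < n → R (i + 1) + (P.d * (P.L - 1) + P.L) * P.L ^ (k + i) ≤ R i :=
    fun i hi => radius_step k n i hi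
  have hclosed := cone_closed_of_radius hn x w R hR D hDmem
  have hwalk := walk_mem_cone_top x w R D hDmem
  have hΛD' : ∀ b, b ∈ ΛD ↔ b ∈ Λ ∧ b ∈ D 0 := fun b =>
    (hΛD b).trans ⟨fun hb => ⟨hb.1, Nat.zero_le _, hb.2⟩, fun hb => ⟨hb.1, hb.2.2⟩⟩
  exact loopDefect_le_of_cone_support h hCd hθ hn D hclosed x w hw hwalk V h1 Λ ΛD hΛD' hoff hD htrunc

end Defect

end Summit.QuantumFields.BalabanUV.T4Continuum.Spine.NE7

end
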